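import Mathlib
import Summits.Ventures.PercRepro2.A3CutBehind
import Summits.Ventures.PercRepro2.A3PendantPath

/-!
# The fibre sums of a vertex behind a cut vertex split
(blind cell PercRepro2, night-1 g32; proofs/NIGHT1-G32.md §5; the expansion is A3CutExpand.lean)

Setting of A3CutBehind: `x` a cut vertex, the marks in `VB ∪ {x}`, `v ∈ VA`.  **`sum_fibre_v_split`**:
every generic fibre sum of `v` (a term `1`-homogeneous in the masses, seeing `W` only through its
`B`-part and constant on the sets inside `VA`) is `c ·` (the `x`-sum) `+ (1 − c) ·` (the unconditioned
term), `c = P(v ↔ x)` — from the scaling of A3CutScale and the fibres of A3CutBehind, exactly as at a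
leaf of weight `c`.  The six sums of `btw`/`FMfun` (`sum_term_cut`, `sum_Ssig_cut`, `sum_SFg_cut`,
`sum_termA_cut`, `sum_SuA_cut`) and `prob_PD_cut`: `D_v = c D_x + (1 − c) P(Q)`.  Standard axioms.
-/

namespace Summit.Ventures.PercRepro2

open UnionCluster CovForm CutV

namespace CovForm

namespace A3Fibre

/-! ## The generic split of the fibre sums of `v` -/

section Split

variable {V : Type*} {E : Type*} [Fintype V] [DecidableEq V] [Fintype E] [DecidableEq E]
  {R : Type*} [Field R] [LinearOrder R] [IsStrictOrderedRing R] {ends : E → Sym2 V} {x : V}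
  {VA VB : Finset V} {EA EB : Set E} [DecidablePred (· ∈ EA)] [DecidablePred (· ∈ EB)] {p : E → R}

omit [Fintype V] [Fintype E] [DecidableEq E] [Field R] [LinearOrder R]
  [IsStrictOrderedRing R] [DecidablePred (· ∈ EA)] [DecidablePred (· ∈ EB)] in
/-- A vertex of `VB ∪ {x}` is not on the `A`-side. -/
lemma notMem_VA_of_mem_VB (h : IsCut ends x ↑VA ↑VB EA EB) {u : V} (hu : u ∈ insert x VB) :
    u ∉ VA := by
  rcases Finset.mem_insert.1 hu with rfl | hu
  · exact fun hA => h.x_notA (Finset.mem_coe.2 hA)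
  · exact fun hA => Finset.disjoint_left.1 (Finset.disjoint_coe.1 h.disj) hA hu

omit [Fintype V] [DecidableEq V] [LinearOrder R] [IsStrictOrderedRing R] [DecidablePred (· ∈ EB)] in
/-- The `A`-side cluster event of `v` at a set not containing `x` and not inside `VA` is null. -/
lemma aV_eq_zero_of_not_subset (h : IsCut ends x ↑VA ↑VB EA EB) {v : V} (hv : v ∈ VA) {W : Finset V}
    (hxW : x ∉ W) (hW : ¬ W ⊆ VA) : prob p (sideEvent EA (clusterEvent ends v (↑W : Set V))) = 0 := by
  have : sideEvent EA (clusterEvent ends v (↑W : Set V)) = ∅ := by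
    ext ω
    simp only [mem_sideEvent, mem_clusterEvent, Set.mem_empty_iff_false, iff_false]
    intro hc
    apply hW
    intro u hu
    have hu' : u ∈ cluster ends (restrict EA ω) v := by rw [hc]; exact Finset.mem_coe.2 hu
    rcases cluster_restrict_subset h (Or.inl (Finset.mem_coe.2 hv)) hu' with huA | hux
    · exact Finset.mem_coe.1 huA
    · rw [Set.mem_singleton_iff] at hux
      exact absurd (hux ▸ hu) hxW
  rw [this, prob_empty]

omit [LinearOrder R] [IsStrictOrderedRing R] in
/-- **The generic fibre sum of `v` splits**: `c ·` (the `x`-sum) `+ (1 − c) ·` (the unconditioned term),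
for a term `T` that is `1`-homogeneous in the masses, sees `W` only through its `B`-part and is constant
on the sets inside `VA`. -/
theorem sum_fibre_v_split (h : IsCut ends x ↑VA ↑VB EA EB) {o a₁ a₂ b : V} (ho : o ∈ insert x VB)
    (h1 : a₁ ∈ insert x VB) (h2 : a₂ ∈ insert x VB) (hb : b ∈ insert x VB) {v : V} (hv : v ∈ VA) (T : Finset V → R → R → R → R → R → R)
    (hThom : ∀ W c m sb so ub uo, T W (c * m) (c * sb) (c * so) (c * ub) (c * uo) =
      c * T W m sb so ub uo)
    (hTB : ∀ S, S ⊆ VA → ∀ W, T (S ∪ W) = T W) (hTA : ∀ W, W ⊆ VA → T W = T ∅) :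
    ∑ W, T W (mW p ends a₁ a₂ v W) (Ssig p ends a₁ a₂ v b W) (Ssig p ends a₁ a₂ v o W)
        (Su p ends a₁ a₂ v b W) (Su p ends a₁ a₂ v o W) =
      prob p (connEvent ends v x) *
        ∑ W, T W (mW p ends a₁ a₂ x W) (Ssig p ends a₁ a₂ x b W) (Ssig p ends a₁ a₂ x o W)
          (Su p ends a₁ a₂ x b W) (Su p ends a₁ a₂ x o W) +
      (1 - prob p (connEvent ends v x)) *
        T ∅ (prob p (avoidAll ends a₂ {a₁}))
          (prob p (avoidAll ends a₂ {a₁} ∩ connEvent ends a₁ b) -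
            prob p (avoidAll ends a₂ {a₁} ∩ connEvent ends a₂ b))
          (prob p (avoidAll ends a₂ {a₁} ∩ connEvent ends a₁ o) -
            prob p (avoidAll ends a₂ {a₁} ∩ connEvent ends a₂ o))
          (prob p (avoidAll ends a₂ {a₁} ∩ connEvent ends a₁ b) +
            prob p (avoidAll ends a₂ {a₁} ∩ connEvent ends a₂ b))
          (prob p (avoidAll ends a₂ {a₁} ∩ connEvent ends a₁ o) +
            prob p (avoidAll ends a₂ {a₁} ∩ connEvent ends a₂ o)) := by
  have hT0 : ∀ W, T W 0 0 0 0 0 = 0 := fun W => by simpa using hThom W 0 0 0 0 0 0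
  have hpt : ∀ W, T W (mW p ends a₁ a₂ v W) (Ssig p ends a₁ a₂ v b W) (Ssig p ends a₁ a₂ v o W)
      (Su p ends a₁ a₂ v b W) (Su p ends a₁ a₂ v o W) =
      T W (mZ p ends a₁ a₂ x (connEvent ends v x) W) (SsigZ p ends a₁ a₂ x b (connEvent ends v x) W)
        (SsigZ p ends a₁ a₂ x o (connEvent ends v x) W) (SuZ p ends a₁ a₂ x b (connEvent ends v x) W)
        (SuZ p ends a₁ a₂ x o (connEvent ends v x) W) +
      (if x ∈ W then 0 else prob p (sideEvent EA (clusterEvent ends v (↑W : Set V)))) *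
        T ∅ (prob p (avoidAll ends a₂ {a₁}))
          (prob p (avoidAll ends a₂ {a₁} ∩ connEvent ends a₁ b) -
            prob p (avoidAll ends a₂ {a₁} ∩ connEvent ends a₂ b))
          (prob p (avoidAll ends a₂ {a₁} ∩ connEvent ends a₁ o) -
            prob p (avoidAll ends a₂ {a₁} ∩ connEvent ends a₂ o))
          (prob p (avoidAll ends a₂ {a₁} ∩ connEvent ends a₁ b) +
            prob p (avoidAll ends a₂ {a₁} ∩ connEvent ends a₂ b))
          (prob p (avoidAll ends a₂ {a₁} ∩ connEvent ends a₁ o) +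
            prob p (avoidAll ends a₂ {a₁} ∩ connEvent ends a₂ o)) := by
    intro W
    rw [mW_v_eq h hv h1 h2, Ssig_v_eq h hv h1 h2 hb, Ssig_v_eq h hv h1 h2 ho, Su_v_eq h hv h1 h2 hb,
      Su_v_eq h hv h1 h2 ho]
    by_cases hxW : x ∈ W
    · simp only [hxW, if_true, add_zero, zero_mul]
    · simp only [hxW, if_false]
      have he := clusterEvent_x_eq_empty_of_notMem (ends := ends) hxW
      rw [mZ_eq_zero_of_empty _ he, SsigZ_eq_zero_of_empty _ he, SsigZ_eq_zero_of_empty _ he,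
        SuZ_eq_zero_of_empty _ he, SuZ_eq_zero_of_empty _ he, hT0, zero_add, zero_add, zero_add,
        zero_add, zero_add, hThom]
      by_cases hWA : W ⊆ VA
      · rw [hTA W hWA, zero_add]
      · rw [aV_eq_zero_of_not_subset h hv hxW hWA]
        ring
  rw [Finset.sum_congr rfl (fun W _ => hpt W), Finset.sum_add_distrib, ← Finset.sum_mul,
    sum_aV_notMem h hv, connEvent_vx_eq_sideEvent h hv,
    sum_fibre_x_scale h ho h1 h2 hb (connEvent ends v x) T hT0 hThom hTB]

omit [Fintype V] [Fintype E] [DecidableEq E] [LinearOrder R] [IsStrictOrderedRing R]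
  [DecidablePred (· ∈ EA)] [DecidablePred (· ∈ EB)] in
/-- `s3` does not see a set avoiding the roots. -/
lemma s3_union_left {a₁ a₂ : V} {S : Finset V} (h1 : a₁ ∉ S) (h2 : a₂ ∉ S) (W : Finset V) :
    (s3 a₁ a₂ (S ∪ W) : R) = s3 a₁ a₂ W := by
  unfold s3
  simp [Finset.mem_union, h1, h2]

omit [Fintype V] [Fintype E] [DecidableEq E] [LinearOrder R] [IsStrictOrderedRing R]
  [DecidablePred (· ∈ EA)] [DecidablePred (· ∈ EB)] in
/-- `s3` vanishes on a set avoiding the roots. -/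
lemma s3_eq_zero_of_notMem {a₁ a₂ : V} {W : Finset V} (h1 : a₁ ∉ W) (h2 : a₂ ∉ W) :
    (s3 a₁ a₂ W : R) = 0 := by
  unfold s3
  simp [h1, h2]

omit [Fintype V] [Fintype E] [DecidableEq E] [Field R] [LinearOrder R] [IsStrictOrderedRing R]
  [DecidablePred (· ∈ EA)] [DecidablePred (· ∈ EB)] in
/-- The `A`-condition does not see a set avoiding the roots. -/
lemma fibresA_cond_union_left {a₁ a₂ : V} {S : Finset V} (h1 : a₁ ∉ S) (h2 : a₂ ∉ S) (W : Finset V) :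
    (a₁ ∉ S ∪ W ∧ a₂ ∉ S ∪ W) ↔ (a₁ ∉ W ∧ a₂ ∉ W) := by
  simp [Finset.mem_union, h1, h2]

end Split

/-! ## The six fibre sums of `btw` and `FMfun` across the cut -/

section Sums

variable {V : Type*} {E : Type*} [Fintype V] [DecidableEq V] [Fintype E] [DecidableEq E]
  {R : Type*} [Field R] {ends : E → Sym2 V} {x : V}
  {VA VB : Finset V} {EA EB : Set E} [DecidablePred (· ∈ EA)] [DecidablePred (· ∈ EB)] {p : E → R}
  {o a₁ a₂ b v : V}

/-- The ratio sum at a constant centring `γ`. -/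
lemma sum_term_cut (h : IsCut ends x ↑VA ↑VB EA EB) (ho : o ∈ insert x VB) (h1 : a₁ ∈ insert x VB)
    (h2 : a₂ ∈ insert x VB) (hb : b ∈ insert x VB) (hv : v ∈ VA) (γ : R) :
    ∑ W, Ssig p ends a₁ a₂ v b W * RootEdge.SFg p ends o a₁ a₂ v γ W / mW p ends a₁ a₂ v W =
      prob p (connEvent ends v x) *
        ∑ W, Ssig p ends a₁ a₂ x b W * RootEdge.SFg p ends o a₁ a₂ x γ W / mW p ends a₁ a₂ x W +
      (1 - prob p (connEvent ends v x)) *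
        ((prob p (avoidAll ends a₂ {a₁} ∩ connEvent ends a₁ b) -
            prob p (avoidAll ends a₂ {a₁} ∩ connEvent ends a₂ b)) *
          (prob p (avoidAll ends a₂ {a₁} ∩ connEvent ends a₁ o) -
            prob p (avoidAll ends a₂ {a₁} ∩ connEvent ends a₂ o)) / prob p (avoidAll ends a₂ {a₁})) := by
  have := sum_fibre_v_split (p := p) h ho h1 h2 hb hv
    (fun W m sb so _ uo => sb * (so + s3 a₁ a₂ W * (γ * m - uo)) / m)
    (fun W (c m sb so ub uo : R) => by
      show c * sb * (c * so + s3 a₁ a₂ W * (γ * (c * m) - c * uo)) / (c * m) =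
        c * (sb * (so + s3 a₁ a₂ W * (γ * m - uo)) / m)
      rw [show c * so + s3 a₁ a₂ W * (γ * (c * m) - c * uo) = c * (so + s3 a₁ a₂ W * (γ * m - uo)) by
        ring]
      exact mul_div_leaf_aux c sb _ m)
    (fun S hS W => by
      funext m sb so ub uo
      rw [s3_union_left (fun hc => notMem_VA_of_mem_VB h h1 (hS hc))
        (fun hc => notMem_VA_of_mem_VB h h2 (hS hc))])
    (fun W hW => by
      funext m sb so ub uo
      rw [s3_eq_zero_of_notMem (fun hc => notMem_VA_of_mem_VB h h1 (hW hc))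
        (fun hc => notMem_VA_of_mem_VB h h2 (hW hc)),
        s3_eq_zero_of_notMem (Finset.notMem_empty a₁) (Finset.notMem_empty a₂)])
  simp only [RootEdge.SFg] at this ⊢
  rw [this]
  simp only [s3_eq_zero_of_notMem (Finset.notMem_empty a₁) (Finset.notMem_empty a₂), zero_mul, add_zero]

/-- The `σ_b`-sum. -/
lemma sum_Ssig_cut (h : IsCut ends x ↑VA ↑VB EA EB) (ho : o ∈ insert x VB) (h1 : a₁ ∈ insert x VB)
    (h2 : a₂ ∈ insert x VB) (hb : b ∈ insert x VB) (hv : v ∈ VA) :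
    ∑ W, Ssig p ends a₁ a₂ v b W =
      prob p (connEvent ends v x) * ∑ W, Ssig p ends a₁ a₂ x b W +
      (1 - prob p (connEvent ends v x)) *
        (prob p (avoidAll ends a₂ {a₁} ∩ connEvent ends a₁ b) -
          prob p (avoidAll ends a₂ {a₁} ∩ connEvent ends a₂ b)) :=
  sum_fibre_v_split (p := p) h ho h1 h2 hb hv (fun _ _ sb _ _ _ => sb) (fun _ _ _ _ _ _ _ => rfl)
    (fun _ _ _ => rfl) (fun _ _ => rfl)

/-- The `F`-sum at a constant centring `γ`. -/
lemma sum_SFg_cut (h : IsCut ends x ↑VA ↑VB EA EB) (ho : o ∈ insert x VB) (h1 : a₁ ∈ insert x VB)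
    (h2 : a₂ ∈ insert x VB) (hb : b ∈ insert x VB) (hv : v ∈ VA) (γ : R) :
    ∑ W, RootEdge.SFg p ends o a₁ a₂ v γ W =
      prob p (connEvent ends v x) * ∑ W, RootEdge.SFg p ends o a₁ a₂ x γ W +
      (1 - prob p (connEvent ends v x)) *
        (prob p (avoidAll ends a₂ {a₁} ∩ connEvent ends a₁ o) -
          prob p (avoidAll ends a₂ {a₁} ∩ connEvent ends a₂ o)) := by
  have := sum_fibre_v_split (p := p) h ho h1 h2 hb hv
    (fun W m _ so _ uo => so + s3 a₁ a₂ W * (γ * m - uo))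
    (fun W (c m sb so ub uo : R) => by
      show c * so + s3 a₁ a₂ W * (γ * (c * m) - c * uo) = c * (so + s3 a₁ a₂ W * (γ * m - uo))
      ring)
    (fun S hS W => by
      funext m sb so ub uo
      rw [s3_union_left (fun hc => notMem_VA_of_mem_VB h h1 (hS hc))
        (fun hc => notMem_VA_of_mem_VB h h2 (hS hc))])
    (fun W hW => by
      funext m sb so ub uo
      rw [s3_eq_zero_of_notMem (fun hc => notMem_VA_of_mem_VB h h1 (hW hc))
        (fun hc => notMem_VA_of_mem_VB h h2 (hW hc)),
        s3_eq_zero_of_notMem (Finset.notMem_empty a₁) (Finset.notMem_empty a₂)])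
  simp only [RootEdge.SFg] at this ⊢
  rw [this]
  simp only [s3_eq_zero_of_notMem (Finset.notMem_empty a₁) (Finset.notMem_empty a₂), zero_mul, add_zero]

/-- The `A`-ratio sum. -/
lemma sum_termA_cut (h : IsCut ends x ↑VA ↑VB EA EB) (ho : o ∈ insert x VB) (h1 : a₁ ∈ insert x VB)
    (h2 : a₂ ∈ insert x VB) (hb : b ∈ insert x VB) (hv : v ∈ VA) :
    ∑ W ∈ fibresA a₁ a₂, Su p ends a₁ a₂ v b W * Su p ends a₁ a₂ v o W / mW p ends a₁ a₂ v W =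
      prob p (connEvent ends v x) *
        ∑ W ∈ fibresA a₁ a₂, Su p ends a₁ a₂ x b W * Su p ends a₁ a₂ x o W / mW p ends a₁ a₂ x W +
      (1 - prob p (connEvent ends v x)) *
        ((prob p (avoidAll ends a₂ {a₁} ∩ connEvent ends a₁ b) +
            prob p (avoidAll ends a₂ {a₁} ∩ connEvent ends a₂ b)) *
          (prob p (avoidAll ends a₂ {a₁} ∩ connEvent ends a₁ o) +
            prob p (avoidAll ends a₂ {a₁} ∩ connEvent ends a₂ o)) / prob p (avoidAll ends a₂ {a₁})) := by
  have := sum_fibre_v_split (p := p) h ho h1 h2 hb hv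
    (fun W m _ _ ub uo => if a₁ ∉ W ∧ a₂ ∉ W then ub * uo / m else 0)
    (fun W (c m sb so ub uo : R) => by
      show (if a₁ ∉ W ∧ a₂ ∉ W then c * ub * (c * uo) / (c * m) else 0) =
        c * (if a₁ ∉ W ∧ a₂ ∉ W then ub * uo / m else 0)
      split_ifs
      · exact mul_div_leaf_aux c ub uo m
      · ring)
    (fun S hS W => by
      funext m sb so ub uo
      simp only [fibresA_cond_union_left (fun hc => notMem_VA_of_mem_VB h h1 (hS hc))
        (fun hc => notMem_VA_of_mem_VB h h2 (hS hc))])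
    (fun W hW => by
      funext m sb so ub uo
      have hA1 : a₁ ∉ W := fun hc => notMem_VA_of_mem_VB h h1 (hW hc)
      have hA2 : a₂ ∉ W := fun hc => notMem_VA_of_mem_VB h h2 (hW hc)
      rw [if_pos ⟨hA1, hA2⟩, if_pos ⟨Finset.notMem_empty a₁, Finset.notMem_empty a₂⟩])
  rw [fibresA, Finset.sum_filter, Finset.sum_filter, this]
  simp only [Finset.notMem_empty, not_false_eq_true, and_self, if_true]

/-- The `A`-sum of `Su_y`. -/
lemma sum_SuA_cut (h : IsCut ends x ↑VA ↑VB EA EB) (ho : o ∈ insert x VB) (h1 : a₁ ∈ insert x VB)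
    (h2 : a₂ ∈ insert x VB) (hb : b ∈ insert x VB) (hv : v ∈ VA) {y : V} (hy : y = b ∨ y = o) :
    ∑ W ∈ fibresA a₁ a₂, Su p ends a₁ a₂ v y W =
      prob p (connEvent ends v x) * ∑ W ∈ fibresA a₁ a₂, Su p ends a₁ a₂ x y W +
      (1 - prob p (connEvent ends v x)) *
        (prob p (avoidAll ends a₂ {a₁} ∩ connEvent ends a₁ y) +
          prob p (avoidAll ends a₂ {a₁} ∩ connEvent ends a₂ y)) := by
  rcases hy with rfl | rfl
  · have := sum_fibre_v_split (p := p) h ho h1 h2 hb hv (fun W _ _ _ ub _ => if a₁ ∉ W ∧ a₂ ∉ W then ub else 0)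
      (fun W (c m sb so ub uo : R) => by
        show (if a₁ ∉ W ∧ a₂ ∉ W then c * ub else 0) = c * (if a₁ ∉ W ∧ a₂ ∉ W then ub else 0)
        split_ifs <;> ring)
      (fun S hS W => by
        funext m sb so ub uo
        simp only [fibresA_cond_union_left (fun hc => notMem_VA_of_mem_VB h h1 (hS hc))
          (fun hc => notMem_VA_of_mem_VB h h2 (hS hc))])
      (fun W hW => by
        funext m sb so ub uo
        have hA1 : a₁ ∉ W := fun hc => notMem_VA_of_mem_VB h h1 (hW hc)
        have hA2 : a₂ ∉ W := fun hc => notMem_VA_of_mem_VB h h2 (hW hc)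
        rw [if_pos ⟨hA1, hA2⟩, if_pos ⟨Finset.notMem_empty a₁, Finset.notMem_empty a₂⟩])
    rw [fibresA, Finset.sum_filter, Finset.sum_filter, this]
    simp only [Finset.notMem_empty, not_false_eq_true, and_self, if_true]
  · have := sum_fibre_v_split (p := p) h ho h1 h2 hb hv (fun W _ _ _ _ uo => if a₁ ∉ W ∧ a₂ ∉ W then uo else 0)
      (fun W (c m sb so ub uo : R) => by
        show (if a₁ ∉ W ∧ a₂ ∉ W then c * uo else 0) = c * (if a₁ ∉ W ∧ a₂ ∉ W then uo else 0)
        split_ifs <;> ring)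
      (fun S hS W => by
        funext m sb so ub uo
        simp only [fibresA_cond_union_left (fun hc => notMem_VA_of_mem_VB h h1 (hS hc))
          (fun hc => notMem_VA_of_mem_VB h h2 (hS hc))])
      (fun W hW => by
        funext m sb so ub uo
        have hA1 : a₁ ∉ W := fun hc => notMem_VA_of_mem_VB h h1 (hW hc)
        have hA2 : a₂ ∉ W := fun hc => notMem_VA_of_mem_VB h h2 (hW hc)
        rw [if_pos ⟨hA1, hA2⟩, if_pos ⟨Finset.notMem_empty a₁, Finset.notMem_empty a₂⟩])
    rw [fibresA, Finset.sum_filter, Finset.sum_filter, this]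
    simp only [Finset.notMem_empty, not_false_eq_true, and_self, if_true]

/-- **`D_v = (1 − c) P(Q) + c D_x`.** -/
lemma prob_PD_cut (h : IsCut ends x ↑VA ↑VB EA EB) (ho : o ∈ insert x VB) (h1 : a₁ ∈ insert x VB)
    (h2 : a₂ ∈ insert x VB) (hb : b ∈ insert x VB) (hv : v ∈ VA) :
    prob p (PDEvent ends a₁ a₂ v) =
      prob p (connEvent ends v x) * prob p (PDEvent ends a₁ a₂ x) +
        (1 - prob p (connEvent ends v x)) * prob p (avoidAll ends a₂ {a₁}) := by
  have := sum_fibre_v_split (p := p) h ho h1 h2 hb hv (fun W m _ _ _ _ => if a₁ ∉ W ∧ a₂ ∉ W then m else 0)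
    (fun W (c m sb so ub uo : R) => by
      show (if a₁ ∉ W ∧ a₂ ∉ W then c * m else 0) = c * (if a₁ ∉ W ∧ a₂ ∉ W then m else 0)
      split_ifs <;> ring)
    (fun S hS W => by
      funext m sb so ub uo
      simp only [fibresA_cond_union_left (fun hc => notMem_VA_of_mem_VB h h1 (hS hc))
        (fun hc => notMem_VA_of_mem_VB h h2 (hS hc))])
    (fun W hW => by
      funext m sb so ub uo
      have hA1 : a₁ ∉ W := fun hc => notMem_VA_of_mem_VB h h1 (hW hc)
      have hA2 : a₂ ∉ W := fun hc => notMem_VA_of_mem_VB h h2 (hW hc)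
      rw [if_pos ⟨hA1, hA2⟩, if_pos ⟨Finset.notMem_empty a₁, Finset.notMem_empty a₂⟩])
  rw [prob_PD_eq, prob_PD_eq, this]
  simp only [Finset.notMem_empty, not_false_eq_true, and_self, if_true]

end Sums

end A3Fibre

end CovForm

end Summit.Ventures.PercRepro2
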